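import Mathlib
import Summits.ResolutionOfSingularities.ResolutionOfSingularities.Theorems.HomologicalConductorPersistenceKC3LowerFactFree
import Summits.ResolutionOfSingularities.ResolutionOfSingularities.Theorems.HomologicalConductorPersistenceKC3Glue
import HarnessLib

/-!
# K-C3 SOCKET S1, producer P-ii: the route's `T₀ = loc O A` as a localization of `A = k[x,y,z,t]/(xy − z³ − t⁴)` at the origin,
# and K2-LOWER at `T₀` from the curve-side bound alone (W4.4b K-C3 §H2L, res-L1-w44b-plan-1 g13 AMEND CUT K-C3 v1.9⁵ (K2), 14:24:35Z)

Route `ResolutionOfSingularities/HomologicalConductor`, chain W4.4b (cell `res-hironaka`), crux `Persistence`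
(stmt-ResolutionOfSingularities-16484), KILL CANDIDATE K-C3, KC3 SPELLING v1.1.  [OURS; AI-written, weaker than expert review; NOT a
statement of the manuscript under study (Hironaka 2017); no named fact is used — the only non-structural hypothesis is the curve-side
bound `hJ`; this file types NO negation of the crux (ROUTE-HYGIENE HOLD, CHAIN §V13.11.3).]

The K-C3 K2-LOWER theorem `PersistenceKC3LowerFactFree.span_le_cohomologyAnnihilator_of_isLocalization_cusp34_of_le` (p537452/rev 2)
speaks about ANY local ring `L` that is a localization of `KC3RingXY k (z³+t⁴) = k[x,y,z,t]/(xy − z³ − t⁴)` at its origin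
`kc3OriginXY`.  The route's literal `T₀ = loc O A` (`A = k[x, z, t, (z³+t⁴)x⁻¹] ⊆ K = k(x,z,t)`, `O` a valuation ring centred at the
origin) was identified by res-type-010 with the model `k[x,y,z,t]_𝔪 ⧸ (xy − z³ − t⁴)` (`KC3Upper.exists_kc3LocModelEquiv`, p534738's
sibling).  This file is THE SOCKET between the two:

* `f0_eq_kc3PolyXY`, `span_algebraMap_f0_eq` — res-type-010's generator `X 0 * X 1 - X 2 ^ 3 - X 3 ^ 4` IS `kc3PolyXY k (z³+t⁴)`, so
  the model is `k[X]_𝔪 ⧸ (kc3PolyXY)·k[X]_𝔪`, Mathlib's `S ⧸ J.map (algebraMap R S)` shape;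
* `exists_socketEquiv` — `e : ↥(loc O A) ≃+* k[X]_𝔪 ⧸ J·k[X]_𝔪` with `e ⟨p(x,y,z,t), _⟩ = (p/1)‾` (res-type-010's `e₀` re-targeted
  along `Ideal.quotEquivOfEq`);
* the `A`-algebra structure on `↥(loc O A)` along such an `e` is `(e.symm ∘ (k[X]/J → k[X]_𝔪/J·k[X]_𝔪)).toAlgebra` — SPELLED OUT in
  the statements and installed with `letI` (this file declares NO definition and NO instance; def-free kernel lane);
  `algebraMap_mk_of_ringEquiv : algebraMap (mk p) = ⟨p(x,y,z,t), _⟩`;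
* **`isLocalization_loc_of_ringEquiv`** — with that structure, `IsLocalization.AtPrime ↥(loc O A) (kc3OriginXY k (z³+t⁴))`
  (Mathlib's localization-of-quotient instance transported along `e.symm`, `IsLocalization.isLocalization_iff_of_ringEquiv`,
  and `𝔪.primeCompl ↦ 𝔬.primeCompl` under `k[X] → A`);
* **`mem_cohomologyAnnihilator_loc_x / _y / _zz / _zt / _tt`** — THE FIVE RING-LEVEL MEMBERSHIPS
  `⟨x,_⟩, ⟨y,_⟩, ⟨z²,_⟩, ⟨zt,_⟩, ⟨t²,_⟩ ∈ cohomologyAnnihilator ↥(loc O A)` from `ringChar k ≠ 2`, `i² = −1` and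
  `hJ : ((z,t)²)·C ≤ ca(C)`, `C = k⟦z,t⟧/(z³+t⁴)` (res-L1-w44b-stub-1's bound-to-be) — exactly the hypotheses `hxT … httT` of
  `KC3Glue.kc3_x_mem_ca_loc_W_of_persistence'` (p536318);
* `kc3_S1_of_le` — the set-level socket `S1` of `KC3Glue.kc3_x_mem_ca_loc_W_of_persistence` at the datum of record
  (`K = Frac k[x,z,t]`, `O = O_(6,5,4)`), from the same three hypotheses.

So P-ii reads: `hJ` (stub-1) ⇒ `S1` (this file) ⇒ with `Persistence`, `x ∈ ca T₁` (KC3Glue); the contradiction with S2 is the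
planner's / priority8's call and is NOT written here.  Filed `--supports stmt-ResolutionOfSingularities-16484 --as helper`.
-/

noncomputable section

-- single-problem summit: the doubled namespace component `ResolutionOfSingularities` is forced
set_option linter.dupNamespace false

namespace Summit.ResolutionOfSingularities.ResolutionOfSingularities.Theorems.HomologicalConductor.PersistenceKC3LowerSocket

open Literature.RingTheory.CohomologyAnnihilator Literature.AlgebraicGeometry.Resolution
open Summit.ResolutionOfSingularities.ResolutionOfSingularities.Theorems.NoZeno.Birth
open Summit.ResolutionOfSingularities.ResolutionOfSingularities.Theorems.HomologicalConductor.PersistenceKC3Completion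
open Summit.ResolutionOfSingularities.ResolutionOfSingularities.Theorems.HomologicalConductor.PersistenceKC3LowerFactFree
open Summit.ResolutionOfSingularities.ResolutionOfSingularities.Theorems.HomologicalConductor.KC3Upper

/-! ## §1 The generator of the model is `kc3PolyXY k (z³ + t⁴)` -/

/-- res-type-010's generator `xy − z³ − t⁴` is `kc3PolyXY k (z³ + t⁴)` (`= xy − (z³ + t⁴)`, `kc3PolyXY_cusp34`). [this work] -/
theorem f0_eq_kc3PolyXY (k : Type) [Field k] :
    (MvPolynomial.X 0 * MvPolynomial.X 1 - MvPolynomial.X 2 ^ 3 - MvPolynomial.X 3 ^ 4 : MvPolynomial (Fin 4) k) =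
      kc3PolyXY k (MvPolynomial.X 0 ^ 3 + MvPolynomial.X 1 ^ 4) := by
  rw [kc3PolyXY_cusp34, sub_sub]

/-- The model's ideal `(xy − z³ − t⁴)·k[X]_𝔪` is the extension `J·k[X]_𝔪` of `J = (kc3PolyXY k (z³+t⁴))` — Mathlib's
`S ⧸ J.map (algebraMap R S)` shape. [this work] -/
theorem span_algebraMap_f0_eq (k : Type) [Field k] :
    Ideal.span {algebraMap (MvPolynomial (Fin 4) k) (Localization.AtPrime (originIdeal k 4))
        (MvPolynomial.X 0 * MvPolynomial.X 1 - MvPolynomial.X 2 ^ 3 - MvPolynomial.X 3 ^ 4)} =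
      (Ideal.span {kc3PolyXY k (MvPolynomial.X 0 ^ 3 + MvPolynomial.X 1 ^ 4)}).map
        (algebraMap (MvPolynomial (Fin 4) k) (Localization.AtPrime (originIdeal k 4))) := by
  rw [Ideal.map_span, Set.image_singleton, f0_eq_kc3PolyXY]

/-- Under `k[X] → A = k[X]/J` (`J ⊆ 𝔪`), the complement of the origin maps ONTO the complement of the origin of `A`:
`𝔪.primeCompl.map mk = 𝔬.primeCompl` (`𝔬 = kc3OriginXY = 𝔪.map mk`). [folklore] -/
theorem algebraMapSubmonoid_primeCompl_eq (k : Type) [Field k]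
    [(kc3OriginXY k (MvPolynomial.X 0 ^ 3 + MvPolynomial.X 1 ^ 4)).IsPrime] :
    Algebra.algebraMapSubmonoid (KC3RingXY k (MvPolynomial.X 0 ^ 3 + MvPolynomial.X 1 ^ 4)) (originIdeal k 4).primeCompl =
      (kc3OriginXY k (MvPolynomial.X 0 ^ 3 + MvPolynomial.X 1 ^ 4)).primeCompl := by
  set hP : MvPolynomial (Fin 2) k := MvPolynomial.X 0 ^ 3 + MvPolynomial.X 1 ^ 4
  have hJm : Ideal.span {kc3PolyXY k hP} ≤ originIdeal k 4 :=
    (Ideal.span_singleton_le_iff_mem _).mpr (kc3PolyXY_mem_originIdeal (constantCoeff_cusp34 k))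
  -- membership in `𝔬 = 𝔪.map mk` is membership in `𝔪` upstairs
  have hmem : ∀ p : MvPolynomial (Fin 4) k, Ideal.Quotient.mk (Ideal.span {kc3PolyXY k hP}) p ∈ kc3OriginXY k hP ↔
      p ∈ originIdeal k 4 := by
    intro p
    rw [kc3OriginXY, Ideal.mem_map_iff_of_surjective _ Ideal.Quotient.mk_surjective]
    constructor
    · rintro ⟨q, hq, hqp⟩
      rw [Ideal.Quotient.eq] at hqp
      have : p = q - (q - p) := by ring
      rw [this]
      exact Ideal.sub_mem _ hq (hJm hqp)
    · intro hp
      exact ⟨p, hp, rfl⟩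
  ext b
  rw [Algebra.algebraMapSubmonoid, Submonoid.mem_map]
  constructor
  · rintro ⟨a, ha, rfl⟩
    rw [Ideal.mem_primeCompl_iff] at ha ⊢
    rw [Ideal.Quotient.algebraMap_eq, hmem]
    exact ha
  · intro hb
    obtain ⟨a, rfl⟩ := Ideal.Quotient.mk_surjective b
    refine ⟨a, ?_, rfl⟩
    rw [Ideal.mem_primeCompl_iff] at hb ⊢
    rwa [hmem] at hb

/-! ## §2 The socket isomorphism and the `A`-algebra structure on `T₀ = loc O A` -/

section Socket

variable (k K : Type) [Field k] [Field K] [Algebra (MvPolynomial (Fin 3) k) K] [IsFractionRing (MvPolynomial (Fin 3) k) K]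
  [Algebra k K] [IsScalarTower k (MvPolynomial (Fin 3) k) K]

/-- `x ∈ K` (local notation only). -/
local notation3 "𝔵" => algebraMap (MvPolynomial (Fin 3) k) K (MvPolynomial.X 0)
/-- `z ∈ K` (local notation only). -/
local notation3 "𝔷" => algebraMap (MvPolynomial (Fin 3) k) K (MvPolynomial.X 1)
/-- `t ∈ K` (local notation only). -/
local notation3 "𝔱" => algebraMap (MvPolynomial (Fin 3) k) K (MvPolynomial.X 2)
/-- `A = k[x, z, t, (z³+t⁴)x⁻¹]` (KC3 SPELLING v1.1; local notation only). -/
local notation3 "𝔸" => Algebra.adjoin k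
  ({algebraMap (MvPolynomial (Fin 3) k) K (MvPolynomial.X 0), algebraMap (MvPolynomial (Fin 3) k) K (MvPolynomial.X 1),
    algebraMap (MvPolynomial (Fin 3) k) K (MvPolynomial.X 2),
    (algebraMap (MvPolynomial (Fin 3) k) K (MvPolynomial.X 1) ^ 3 + algebraMap (MvPolynomial (Fin 3) k) K (MvPolynomial.X 2) ^ 4) *
      (algebraMap (MvPolynomial (Fin 3) k) K (MvPolynomial.X 0))⁻¹} : Set K)
/-- the point `(x, y, z, t)` with `y = (z³+t⁴)x⁻¹` (local notation only). -/
local notation3 "𝔤" => (![algebraMap (MvPolynomial (Fin 3) k) K (MvPolynomial.X 0),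
    (algebraMap (MvPolynomial (Fin 3) k) K (MvPolynomial.X 1) ^ 3 + algebraMap (MvPolynomial (Fin 3) k) K (MvPolynomial.X 2) ^ 4) *
      (algebraMap (MvPolynomial (Fin 3) k) K (MvPolynomial.X 0))⁻¹,
    algebraMap (MvPolynomial (Fin 3) k) K (MvPolynomial.X 1), algebraMap (MvPolynomial (Fin 3) k) K (MvPolynomial.X 2)] :
    Fin 4 → K)
/-- the cusp polynomial `z³ + t⁴ ∈ k[z,t]` (local notation only). -/
local notation3 "𝔥" => (MvPolynomial.X 0 ^ 3 + MvPolynomial.X 1 ^ 4 : MvPolynomial (Fin 2) k)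
/-- the model `k[X]_𝔪 ⧸ J·k[X]_𝔪` (local notation only). -/
local notation3 "𝕄" => Localization.AtPrime (originIdeal k 4) ⧸
  (Ideal.span {kc3PolyXY k (MvPolynomial.X 0 ^ 3 + MvPolynomial.X 1 ^ 4)}).map
    (algebraMap (MvPolynomial (Fin 4) k) (Localization.AtPrime (originIdeal k 4)))

omit [IsScalarTower k (MvPolynomial (Fin 3) k) K] in
/-- Every polynomial expression `p(x, y, z, t)` lies in `T₀ = loc O A`. [folklore] -/
theorem aeval_mem_loc (O : ValuationSubring K) (p : MvPolynomial (Fin 4) k) : MvPolynomial.aeval 𝔤 p ∈ loc O 𝔸 := by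
  apply mem_loc_of_mem O
  rw [← range_aeval_kc3 k K]
  exact ⟨p, rfl⟩

/-- **The socket isomorphism** `e : ↥(loc O A) ≃+* k[X]_𝔪 ⧸ J·k[X]_𝔪`, `J = (kc3PolyXY k (z³+t⁴))`, with
`e ⟨p(x,y,z,t), _⟩ = (p/1)‾` — res-type-010's `exists_kc3LocModelEquiv` followed by `Ideal.quotEquivOfEq span_algebraMap_f0_eq`.
[OURS] -/
theorem exists_socketEquiv (O : ValuationSubring K) (hk : ∀ c : k, algebraMap k K c ∈ O)
    (hx : O.valuation 𝔵 < 1) (hy : O.valuation ((𝔷 ^ 3 + 𝔱 ^ 4) * 𝔵⁻¹) < 1) (hz : O.valuation 𝔷 < 1) (ht : O.valuation 𝔱 < 1) :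
    ∃ e : ↥(loc O 𝔸) ≃+* 𝕄, ∀ p : MvPolynomial (Fin 4) k,
      e ⟨MvPolynomial.aeval 𝔤 p, aeval_mem_loc k K O p⟩ =
        Ideal.Quotient.mk _ (algebraMap (MvPolynomial (Fin 4) k) (Localization.AtPrime (originIdeal k 4)) p) := by
  obtain ⟨e, he⟩ := exists_kc3LocModelEquiv k K O hk hx hy hz ht
  refine ⟨e.trans (Ideal.quotEquivOfEq (span_algebraMap_f0_eq k)), fun p => ?_⟩
  rw [RingEquiv.trans_apply, he p, Ideal.quotEquivOfEq_mk]

omit [IsFractionRing (MvPolynomial (Fin 3) k) K] [IsScalarTower k (MvPolynomial (Fin 3) k) K] in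
/-- **`T₀` IS A LOCALIZATION OF `A` AT ITS ORIGIN along any socket isomorphism**: for a ring isomorphism
`e : ↥(loc O A) ≃+* k[X]_𝔪 ⧸ J·k[X]_𝔪` give `↥(loc O A)` the `A`-algebra structure `e⁻¹ ∘ (A → k[X]_𝔪/J·k[X]_𝔪)`
(`A = KC3RingXY k (z³+t⁴)`); then `IsLocalization.AtPrime ↥(loc O A) (kc3OriginXY k (z³+t⁴))`.  Mathlib's instance «`k[X]_𝔪/J·k[X]_𝔪`
is the localization of `k[X]/J` at the image of `𝔪.primeCompl`» transported by `IsLocalization.isLocalization_iff_of_ringEquiv`, and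
`algebraMapSubmonoid_primeCompl_eq`.  (The algebra structure is spelled out in the statement and installed with `letI` by consumers;
no instance and no definition is declared.) [OURS] -/
theorem isLocalization_loc_of_ringEquiv (O : ValuationSubring K) (e : ↥(loc O 𝔸) ≃+* 𝕄) [(kc3OriginXY k 𝔥).IsPrime] :
    letI := (e.symm.toRingHom.comp (algebraMap (KC3RingXY k 𝔥) 𝕄)).toAlgebra
    IsLocalization.AtPrime ↥(loc O 𝔸) (kc3OriginXY k 𝔥) := by
  have h := (IsLocalization.isLocalization_iff_of_ringEquiv
    (Algebra.algebraMapSubmonoid (KC3RingXY k 𝔥) (originIdeal k 4).primeCompl) (S := 𝕄) e.symm).mp inferInstance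
  rw [algebraMapSubmonoid_primeCompl_eq] at h
  exact h

omit [IsScalarTower k (MvPolynomial (Fin 3) k) K] in
/-- **Values of the structure map** along a socket isomorphism with `e ⟨p(x,y,z,t), _⟩ = (p/1)‾`:
`algebraMap A T₀ (p̄) = ⟨p(x, y, z, t), _⟩`. [OURS] -/
theorem algebraMap_mk_of_ringEquiv (O : ValuationSubring K) (e : ↥(loc O 𝔸) ≃+* 𝕄)
    (he : ∀ p : MvPolynomial (Fin 4) k, e ⟨MvPolynomial.aeval 𝔤 p, aeval_mem_loc k K O p⟩ =
      Ideal.Quotient.mk _ (algebraMap (MvPolynomial (Fin 4) k) (Localization.AtPrime (originIdeal k 4)) p))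
    (p : MvPolynomial (Fin 4) k) :
    letI := (e.symm.toRingHom.comp (algebraMap (KC3RingXY k 𝔥) 𝕄)).toAlgebra
    algebraMap (KC3RingXY k 𝔥) ↥(loc O 𝔸) (Ideal.Quotient.mk _ p) = ⟨MvPolynomial.aeval 𝔤 p, aeval_mem_loc k K O p⟩ := by
  letI := (e.symm.toRingHom.comp (algebraMap (KC3RingXY k 𝔥) 𝕄)).toAlgebra
  change e.symm (algebraMap (KC3RingXY k 𝔥) 𝕄 (Ideal.Quotient.mk _ p)) = _
  rw [RingEquiv.symm_apply_eq, he]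
  rfl

/-! ## §3 The five ring-level memberships at `T₀` from the curve-side bound (SOCKET S1, producer P-ii) -/

/-- **K2-LOWER AT THE ROUTE'S `T₀`, generator by generator** (master form): for `ringChar k ≠ 2`, `i² = −1` and the curve-side
bound `hJ : ((z,t)²)·C ≤ ca(C)` (`C = k⟦z,t⟧/(z³+t⁴)`), every polynomial expression among `x, y, z², zt, t²` — indeed
`algebraMap A T₀` of each of the five generators — lies in `cohomologyAnnihilator ↥(loc O A)`. [OURS] -/
theorem aeval_mem_cohomologyAnnihilator_loc (O : ValuationSubring K) (hk : ∀ c : k, algebraMap k K c ∈ O)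
    (hx : O.valuation 𝔵 < 1) (hy : O.valuation ((𝔷 ^ 3 + 𝔱 ^ 4) * 𝔵⁻¹) < 1) (hz : O.valuation 𝔷 < 1) (ht : O.valuation 𝔱 < 1)
    (hchar : ringChar k ≠ 2) (i : k) (hi : i ^ 2 = -1)
    (hJ : ((Ideal.span {(MvPowerSeries.X 0 : MvPowerSeries (Fin 2) k), MvPowerSeries.X 1}) ^ 2).map
        (Ideal.Quotient.mk (Ideal.span {(MvPowerSeries.X 0 ^ 3 + MvPowerSeries.X 1 ^ 4 : MvPowerSeries (Fin 2) k)})) ≤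
      cohomologyAnnihilator (MvPowerSeries (Fin 2) k ⧸
        Ideal.span {(MvPowerSeries.X 0 ^ 3 + MvPowerSeries.X 1 ^ 4 : MvPowerSeries (Fin 2) k)}))
    (p : MvPolynomial (Fin 4) k)
    (hp : p = MvPolynomial.X 0 ∨ p = MvPolynomial.X 1 ∨ p = MvPolynomial.X 2 ^ 2 ∨ p = MvPolynomial.X 2 * MvPolynomial.X 3 ∨
      p = MvPolynomial.X 3 ^ 2) :
    (⟨MvPolynomial.aeval 𝔤 p, aeval_mem_loc k K O p⟩ : ↥(loc O 𝔸)) ∈ cohomologyAnnihilator ↥(loc O 𝔸) := by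
  obtain ⟨e, he⟩ := exists_socketEquiv k K O hk hx hy hz ht
  letI := (e.symm.toRingHom.comp (algebraMap (KC3RingXY k 𝔥) 𝕄)).toAlgebra
  haveI : (kc3OriginXY k 𝔥).IsPrime := kc3OriginXY_isPrime (constantCoeff_cusp34 k)
  haveI : IsLocalization.AtPrime ↥(loc O 𝔸) (kc3OriginXY k 𝔥) := isLocalization_loc_of_ringEquiv k K O e
  haveI : IsLocalRing ↥(loc O 𝔸) :=
    IsLocalization.AtPrime.isLocalRing ↥(loc O 𝔸) (kc3OriginXY k 𝔥)
  have H := span_le_cohomologyAnnihilator_of_isLocalization_cusp34_of_le k hchar i hi hJ ↥(loc O 𝔸)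
  rw [← algebraMap_mk_of_ringEquiv k K O e he p]
  apply H
  apply Ideal.subset_span
  rcases hp with rfl | rfl | rfl | rfl | rfl <;> simp

/-- `⟨x, _⟩ ∈ cohomologyAnnihilator ↥(loc O A)` — hypothesis `hxT` of `KC3Glue.kc3_x_mem_ca_loc_W_of_persistence'`. [OURS] -/
theorem mem_cohomologyAnnihilator_loc_x (O : ValuationSubring K) (hk : ∀ c : k, algebraMap k K c ∈ O)
    (hx : O.valuation 𝔵 < 1) (hy : O.valuation ((𝔷 ^ 3 + 𝔱 ^ 4) * 𝔵⁻¹) < 1) (hz : O.valuation 𝔷 < 1) (ht : O.valuation 𝔱 < 1)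
    (hchar : ringChar k ≠ 2) (i : k) (hi : i ^ 2 = -1)
    (hJ : ((Ideal.span {(MvPowerSeries.X 0 : MvPowerSeries (Fin 2) k), MvPowerSeries.X 1}) ^ 2).map
        (Ideal.Quotient.mk (Ideal.span {(MvPowerSeries.X 0 ^ 3 + MvPowerSeries.X 1 ^ 4 : MvPowerSeries (Fin 2) k)})) ≤
      cohomologyAnnihilator (MvPowerSeries (Fin 2) k ⧸
        Ideal.span {(MvPowerSeries.X 0 ^ 3 + MvPowerSeries.X 1 ^ 4 : MvPowerSeries (Fin 2) k)}))
    (h : 𝔵 ∈ loc O 𝔸) : (⟨𝔵, h⟩ : ↥(loc O 𝔸)) ∈ cohomologyAnnihilator ↥(loc O 𝔸) := by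
  have := aeval_mem_cohomologyAnnihilator_loc k K O hk hx hy hz ht hchar i hi hJ (MvPolynomial.X 0) (Or.inl rfl)
  convert this using 2
  simp

/-- `⟨y, _⟩ ∈ cohomologyAnnihilator ↥(loc O A)`, `y = (z³+t⁴)x⁻¹` — hypothesis `hyT` of the primed glue. [OURS] -/
theorem mem_cohomologyAnnihilator_loc_y (O : ValuationSubring K) (hk : ∀ c : k, algebraMap k K c ∈ O)
    (hx : O.valuation 𝔵 < 1) (hy : O.valuation ((𝔷 ^ 3 + 𝔱 ^ 4) * 𝔵⁻¹) < 1) (hz : O.valuation 𝔷 < 1) (ht : O.valuation 𝔱 < 1)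
    (hchar : ringChar k ≠ 2) (i : k) (hi : i ^ 2 = -1)
    (hJ : ((Ideal.span {(MvPowerSeries.X 0 : MvPowerSeries (Fin 2) k), MvPowerSeries.X 1}) ^ 2).map
        (Ideal.Quotient.mk (Ideal.span {(MvPowerSeries.X 0 ^ 3 + MvPowerSeries.X 1 ^ 4 : MvPowerSeries (Fin 2) k)})) ≤
      cohomologyAnnihilator (MvPowerSeries (Fin 2) k ⧸
        Ideal.span {(MvPowerSeries.X 0 ^ 3 + MvPowerSeries.X 1 ^ 4 : MvPowerSeries (Fin 2) k)}))
    (h : (𝔷 ^ 3 + 𝔱 ^ 4) * 𝔵⁻¹ ∈ loc O 𝔸) : (⟨(𝔷 ^ 3 + 𝔱 ^ 4) * 𝔵⁻¹, h⟩ : ↥(loc O 𝔸)) ∈ cohomologyAnnihilator ↥(loc O 𝔸) := by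
  have := aeval_mem_cohomologyAnnihilator_loc k K O hk hx hy hz ht hchar i hi hJ (MvPolynomial.X 1) (Or.inr (Or.inl rfl))
  convert this using 2
  simp

/-- `⟨z², _⟩ ∈ cohomologyAnnihilator ↥(loc O A)` — hypothesis `hzzT` of the primed glue. [OURS] -/
theorem mem_cohomologyAnnihilator_loc_zz (O : ValuationSubring K) (hk : ∀ c : k, algebraMap k K c ∈ O)
    (hx : O.valuation 𝔵 < 1) (hy : O.valuation ((𝔷 ^ 3 + 𝔱 ^ 4) * 𝔵⁻¹) < 1) (hz : O.valuation 𝔷 < 1) (ht : O.valuation 𝔱 < 1)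
    (hchar : ringChar k ≠ 2) (i : k) (hi : i ^ 2 = -1)
    (hJ : ((Ideal.span {(MvPowerSeries.X 0 : MvPowerSeries (Fin 2) k), MvPowerSeries.X 1}) ^ 2).map
        (Ideal.Quotient.mk (Ideal.span {(MvPowerSeries.X 0 ^ 3 + MvPowerSeries.X 1 ^ 4 : MvPowerSeries (Fin 2) k)})) ≤
      cohomologyAnnihilator (MvPowerSeries (Fin 2) k ⧸
        Ideal.span {(MvPowerSeries.X 0 ^ 3 + MvPowerSeries.X 1 ^ 4 : MvPowerSeries (Fin 2) k)}))
    (h : 𝔷 ^ 2 ∈ loc O 𝔸) : (⟨𝔷 ^ 2, h⟩ : ↥(loc O 𝔸)) ∈ cohomologyAnnihilator ↥(loc O 𝔸) := by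
  have := aeval_mem_cohomologyAnnihilator_loc k K O hk hx hy hz ht hchar i hi hJ (MvPolynomial.X 2 ^ 2)
    (Or.inr (Or.inr (Or.inl rfl)))
  convert this using 2
  simp

/-- `⟨zt, _⟩ ∈ cohomologyAnnihilator ↥(loc O A)` — hypothesis `hztT` of the primed glue. [OURS] -/
theorem mem_cohomologyAnnihilator_loc_zt (O : ValuationSubring K) (hk : ∀ c : k, algebraMap k K c ∈ O)
    (hx : O.valuation 𝔵 < 1) (hy : O.valuation ((𝔷 ^ 3 + 𝔱 ^ 4) * 𝔵⁻¹) < 1) (hz : O.valuation 𝔷 < 1) (ht : O.valuation 𝔱 < 1)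
    (hchar : ringChar k ≠ 2) (i : k) (hi : i ^ 2 = -1)
    (hJ : ((Ideal.span {(MvPowerSeries.X 0 : MvPowerSeries (Fin 2) k), MvPowerSeries.X 1}) ^ 2).map
        (Ideal.Quotient.mk (Ideal.span {(MvPowerSeries.X 0 ^ 3 + MvPowerSeries.X 1 ^ 4 : MvPowerSeries (Fin 2) k)})) ≤
      cohomologyAnnihilator (MvPowerSeries (Fin 2) k ⧸
        Ideal.span {(MvPowerSeries.X 0 ^ 3 + MvPowerSeries.X 1 ^ 4 : MvPowerSeries (Fin 2) k)}))
    (h : 𝔷 * 𝔱 ∈ loc O 𝔸) : (⟨𝔷 * 𝔱, h⟩ : ↥(loc O 𝔸)) ∈ cohomologyAnnihilator ↥(loc O 𝔸) := by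
  have := aeval_mem_cohomologyAnnihilator_loc k K O hk hx hy hz ht hchar i hi hJ (MvPolynomial.X 2 * MvPolynomial.X 3)
    (Or.inr (Or.inr (Or.inr (Or.inl rfl))))
  convert this using 2
  simp

/-- `⟨t², _⟩ ∈ cohomologyAnnihilator ↥(loc O A)` — hypothesis `httT` of the primed glue. [OURS] -/
theorem mem_cohomologyAnnihilator_loc_tt (O : ValuationSubring K) (hk : ∀ c : k, algebraMap k K c ∈ O)
    (hx : O.valuation 𝔵 < 1) (hy : O.valuation ((𝔷 ^ 3 + 𝔱 ^ 4) * 𝔵⁻¹) < 1) (hz : O.valuation 𝔷 < 1) (ht : O.valuation 𝔱 < 1)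
    (hchar : ringChar k ≠ 2) (i : k) (hi : i ^ 2 = -1)
    (hJ : ((Ideal.span {(MvPowerSeries.X 0 : MvPowerSeries (Fin 2) k), MvPowerSeries.X 1}) ^ 2).map
        (Ideal.Quotient.mk (Ideal.span {(MvPowerSeries.X 0 ^ 3 + MvPowerSeries.X 1 ^ 4 : MvPowerSeries (Fin 2) k)})) ≤
      cohomologyAnnihilator (MvPowerSeries (Fin 2) k ⧸
        Ideal.span {(MvPowerSeries.X 0 ^ 3 + MvPowerSeries.X 1 ^ 4 : MvPowerSeries (Fin 2) k)}))
    (h : 𝔱 ^ 2 ∈ loc O 𝔸) : (⟨𝔱 ^ 2, h⟩ : ↥(loc O 𝔸)) ∈ cohomologyAnnihilator ↥(loc O 𝔸) := by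
  have := aeval_mem_cohomologyAnnihilator_loc k K O hk hx hy hz ht hchar i hi hJ (MvPolynomial.X 3 ^ 2)
    (Or.inr (Or.inr (Or.inr (Or.inr rfl))))
  convert this using 2
  simp

end Socket

/-! ## §4 The set-level socket `S1` at the datum of record (`K = Frac k[x,z,t]`, `O = O_(6,5,4)`) -/

section Datum

open Summit.ResolutionOfSingularities.ResolutionOfSingularities.Theorems.HomologicalConductor.PersistenceMonomialValuation
open Summit.ResolutionOfSingularities.ResolutionOfSingularities.Theorems.HomologicalConductor.KC3Glue

variable {k : Type} [Field k]

/-- `K = Frac k[x,z,t]` (local notation only, as in `KC3Glue`). -/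
local notation3 "𝕂" => FractionRing (MvPolynomial (Fin 3) k)
/-- `x ∈ K` (local notation only). -/
local notation3 "𝔵" => algebraMap (MvPolynomial (Fin 3) k) (FractionRing (MvPolynomial (Fin 3) k)) (MvPolynomial.X 0)
/-- `z ∈ K` (local notation only). -/
local notation3 "𝔷" => algebraMap (MvPolynomial (Fin 3) k) (FractionRing (MvPolynomial (Fin 3) k)) (MvPolynomial.X 1)
/-- `t ∈ K` (local notation only). -/
local notation3 "𝔱" => algebraMap (MvPolynomial (Fin 3) k) (FractionRing (MvPolynomial (Fin 3) k)) (MvPolynomial.X 2)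
/-- `O = O_w`, the monomial valuation ring of weights `(6,5,4) = kc3Weight 1` (res-type-084; local notation only). -/
local notation3 "𝕆" => monomialValuationRing k (kc3Weight 1) (FractionRing (MvPolynomial (Fin 3) k))
/-- `A = k[x, z, t, (z³+t⁴)x⁻¹]` (spelled as in `KC3Glue`; local notation only). -/
local notation3 "𝔸" => Algebra.adjoin k
  ({algebraMap (MvPolynomial (Fin 3) k) (FractionRing (MvPolynomial (Fin 3) k)) (MvPolynomial.X 0),
    algebraMap (MvPolynomial (Fin 3) k) (FractionRing (MvPolynomial (Fin 3) k)) (MvPolynomial.X 1),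
    algebraMap (MvPolynomial (Fin 3) k) (FractionRing (MvPolynomial (Fin 3) k)) (MvPolynomial.X 2),
    (algebraMap (MvPolynomial (Fin 3) k) (FractionRing (MvPolynomial (Fin 3) k)) (MvPolynomial.X 1) ^ 3 +
        algebraMap (MvPolynomial (Fin 3) k) (FractionRing (MvPolynomial (Fin 3) k)) (MvPolynomial.X 2) ^ 4) *
      (algebraMap (MvPolynomial (Fin 3) k) (FractionRing (MvPolynomial (Fin 3) k)) (MvPolynomial.X 0))⁻¹} :
    Set (FractionRing (MvPolynomial (Fin 3) k)))

/-- **SOCKET S1 FROM THE CURVE-SIDE BOUND (producer P-ii, OURS · w44b K-C3)**: at the K-C3 datum of record (`k` a field with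
`ringChar k ≠ 2` containing `i` with `i² = −1`; `K = Frac k[x,z,t]`, `O = O_(6,5,4)` = `monomialValuationRing k (kc3Weight 1) K`,
`A = k[x,z,t,(z³+t⁴)x⁻¹]`, `T₀ = loc O A`), the curve-side bound `hJ : ((z,t)²)·C ≤ ca(C)` for `C = k⟦z,t⟧/(z³+t⁴)` gives the
K2-LOWER socket `S1 : {αx + βy + γz² + δzt + εt² | α,…,ε ∈ T₀} ⊆ ca T₀` of `KC3Glue.kc3_x_mem_ca_loc_W_of_persistence`
(same spelling) — via `mem_cohomologyAnnihilator_loc_x … _tt` and `KC3Glue.kc3_lower_subset_of_mem`; the valuation side conditions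
are `KC3Glue.kc3_valuation_lt_one`, `kc3_algebraMap_base_mem`.  Positive statement; nothing about the crux is concluded here. [OURS] -/
theorem kc3_S1_of_le (hchar : ringChar k ≠ 2) (i : k) (hi : i ^ 2 = -1)
    (hJ : ((Ideal.span {(MvPowerSeries.X 0 : MvPowerSeries (Fin 2) k), MvPowerSeries.X 1}) ^ 2).map
        (Ideal.Quotient.mk (Ideal.span {(MvPowerSeries.X 0 ^ 3 + MvPowerSeries.X 1 ^ 4 : MvPowerSeries (Fin 2) k)})) ≤
      cohomologyAnnihilator (MvPowerSeries (Fin 2) k ⧸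
        Ideal.span {(MvPowerSeries.X 0 ^ 3 + MvPowerSeries.X 1 ^ 4 : MvPowerSeries (Fin 2) k)})) :
    {c : 𝕂 | ∃ α β γ δ ε : 𝕂, α ∈ loc 𝕆 𝔸 ∧ β ∈ loc 𝕆 𝔸 ∧ γ ∈ loc 𝕆 𝔸 ∧ δ ∈ loc 𝕆 𝔸 ∧ ε ∈ loc 𝕆 𝔸 ∧
        c = α * 𝔵 + β * ((𝔷 ^ 3 + 𝔱 ^ 4) * 𝔵⁻¹) + γ * 𝔷 ^ 2 + δ * (𝔷 * 𝔱) + ε * 𝔱 ^ 2} ⊆ NoZeno.Birth.ca (loc 𝕆 𝔸) := by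
  have hk : ∀ c : k, algebraMap k 𝕂 c ∈ 𝕆 := kc3_algebraMap_base_mem k 𝕂 1
  obtain ⟨hx, hy, hz, ht⟩ := kc3_valuation_lt_one (k := k)
  exact kc3_lower_subset_of_mem 𝕆
    (mem_cohomologyAnnihilator_loc_x k 𝕂 𝕆 hk hx hy hz ht hchar i hi hJ)
    (mem_cohomologyAnnihilator_loc_y k 𝕂 𝕆 hk hx hy hz ht hchar i hi hJ)
    (mem_cohomologyAnnihilator_loc_zz k 𝕂 𝕆 hk hx hy hz ht hchar i hi hJ)
    (mem_cohomologyAnnihilator_loc_zt k 𝕂 𝕆 hk hx hy hz ht hchar i hi hJ)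
    (mem_cohomologyAnnihilator_loc_tt k 𝕂 𝕆 hk hx hy hz ht hchar i hi hJ)

end Datum

end Summit.ResolutionOfSingularities.ResolutionOfSingularities.Theorems.HomologicalConductor.PersistenceKC3LowerSocket

end
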